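import Literature.NumberTheory.GaloisRepresentations.IdelePlaceReadout
import Literature.NumberTheory.Automorphic.AdeleBaseChange
import HarnessLib

/-!
# The place readouts `π_v : J_E → K̄_vˣ` are compatible with base change `J_E → J_{E'}` (`E ⊆ E'`):
# rigidity of the distinguished place and embedding, at finite and infinite places
# (Cassels–Fröhlich II §10, VII §1.1; Neukirch II (8.1)–(8.3))

Topic `NumberTheory/GaloisRepresentations`; namespace `Literature.NumberTheory.GaloisRepresentations.IdeleReadout`
(`ArchHerbrand`, `SemiLocal` and the scoped `NumberField.LiesOver` algebra structures opened).  Definitions with bodies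
(two tower algebra maps, two "place below" helpers) and theorems; NO named fact, no `sorry`, no instance, no notation;
number fields in `Type`.

THE POINT (door-c6 g17 FINDING §2, (R-def): an idèle projection `π_v : J̄ = lim→_E J_E → K̄_vˣ`).  Door-c5 g17 built
the LAYER readouts `idelePlaceReadout v ιE : J_E → K̄_vˣ` (finite `v`: the `w_v`-component followed by
`placeEmb : E_{w_v} → K̄_v`) and `ideleInfPlaceReadout` (infinite `v`, `archPlaceEmb`).  To pass to the limit they must
be COMPATIBLE WITH BASE CHANGE: for number fields `K ⊆ E ⊆ E'` (both Galois over `K`) with compatible embeddings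
`ιE = ιE' ∘ (E ⊆ E')` into `K̄`,

  `π_v^{E'} (x ↦ J_{E'}) = π_v^{E} (x)`     (`idelePlaceReadout_ideleBaseChange`, `ideleInfPlaceReadout_ideleBaseChange`).

Since `(x ↦ J_{E'})_{w'} = (E_{w} → E'_{w'})(x_{w})` for `w = w' ∩ E` (the tree's `AdeleRing.ideleBaseChange`,
componentwise `adicCompletionOfUnder` / `infiniteCompletionOfComap`), this is the RIGIDITY of the distinguished datum
`(w_v, E_{w_v} → K̄_v)`: a place `w ∣ v` of `E` carrying a `K_v`-algebra map `E_w → K̄_v` that extends `ι_v ∘ ιE` IS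
`w_v`, and the map IS the distinguished embedding.  At finite places this is door-c5 g17's `eq_embPlace_of_algHom` /
`algHom_apply_eq_placeEmb` (`E_w = K_v E`); at infinite places we prove it here from the local Galois model
(`LocalModel`, `Stab(w_v) ≃ Gal(E_{w_v}/K_v)`): **`LocalModel.exists_eq_of_algHom`** — a `K_v`-algebra map `ψ : L → K̄_v`
with `ψ ∘ j = ι_v ∘ ιE ∘ g` forces `g ∈ S` and `ψ = φ ∘ δ(g)` (two `K_v`-embeddings of the normal `L` differ by
`Gal(L/K_v) = δ(S)`, and `ι_v ∘ ιE` is injective) — whence **`eq_archEmbPlace_of_algHom`**, **`algHom_apply_eq_archPlaceEmb`**.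

## What is formalised
* §1 `LocalModel.exists_eq_of_algHom`, `LocalModel.mem_of_algHom`, `LocalModel.apply_eq_of_algHom` (rigidity engine).
* §2 (infinite `v`) `isOver_comap_of_isOver`, `eq_archEmbPlace_of_algHom`, `algHom_apply_eq_archPlaceEmb`.
* §3 (finite `v`, `E ⊆ E'`) `underPlace w'` (`w' ∩ E` as a place over `v`), `placeTowerAlgHom w' : E_{w'∩E} →ₐ[K_v] E'_{w'}`,
  `underPlace_embPlace : w'_v ∩ E = w_v`, **`idelePlaceReadout_ideleBaseChange`**.
* §4 (infinite `v`) `archTowerAlgHom`, `comap_archEmbPlace : w'_v|_E = w_v`, **`ideleInfPlaceReadout_ideleBaseChange`**.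

## References
* J. W. S. Cassels, A. Fröhlich (eds.), *Algebraic Number Theory* (1967), Ch. II §10, Ch. VII (Tate) §1.1. [CasselsFrohlichANT1967]
* J. Neukirch, *Algebraic Number Theory* (1999), Ch. II (8.1)–(8.3). [NeukirchANT1999]
* J. S. Milne, *Arithmetic Duality Theorems* (2nd ed. 2006), I Lemma 4.13 (proof). [MilneADT2006]
-/

noncomputable section

universe u

open NumberField NumberField.InfinitePlace IsDedekindDomain Field
open Literature.NumberTheory.Automorphic
open scoped NumberField.LiesOver

namespace Literature.NumberTheory.GaloisRepresentations

namespace IdeleReadout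

/-! ## §1. Rigidity in the local Galois model -/

namespace LocalModel

variable {K : Type u} [Field K] {Kv : Type u} [Field Kv] [Algebra K Kv]
variable {E : Type u} [Field E] [Algebra K E] [Normal K E] {ιE : E →ₐ[K] AlgebraicClosure K}
variable {L : Type u} [Field L] [Algebra Kv L] [Normal Kv L]
variable {j : E →+* L} {φ : L →ₐ[Kv] AlgebraicClosure Kv}
variable {S : Subgroup (E ≃ₐ[K] E)} {δ : S →* (L ≃ₐ[Kv] L)}
variable (hφ : ∀ e : E, φ (j e) = absClosureEmbedding K Kv (ιE e))
  (hδ : Function.Bijective δ) (hδj : ∀ (s : S) (e : E), δ s (j e) = j ((s : E ≃ₐ[K] E) e))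
include hφ hδ hδj

omit [Normal K E] in
/-- **Rigidity of the model embedding**: a `K_v`-algebra map `ψ : L → K̄_v` whose restriction to `E` is `ι_v ∘ ιE ∘ g`
(`g ∈ Gal(E/K)`) is `φ ∘ δ(s)` for an `s ∈ S` with `s = g` (two `K_v`-embeddings of the normal `L` differ by an element
of `Gal(L/K_v) = δ(S)`; compare on `E` through the injective `ι_v ∘ ιE`). [cite: CasselsFrohlichANT1967, Ch. VII §1.1]
[cite: NeukirchANT1999, Ch. II (8.1)–(8.3)] -/
theorem exists_eq_of_algHom (ψ : L →ₐ[Kv] AlgebraicClosure Kv) (g : E ≃ₐ[K] E)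
    (hψ : ∀ e : E, ψ (j e) = absClosureEmbedding K Kv (ιE (g e))) :
    ∃ s : S, (s : E ≃ₐ[K] E) = g ∧ ∀ y : L, ψ y = φ (δ s y) := by
  letI := algebraOfφ φ
  haveI := isScalarTower_algebraOfφ φ
  let τ : L ≃ₐ[Kv] L := ψ.restrictNormal' L
  have hτ : ∀ y, φ (τ y) = ψ y := fun y => by
    have h := AlgHom.restrictNormal_commutes ψ L y
    rw [Algebra.algebraMap_self, RingHom.id_apply] at h
    exact h
  have hds : δ ((MulEquiv.ofBijective δ hδ).symm τ) = τ := (MulEquiv.ofBijective δ hδ).apply_symm_apply τ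
  refine ⟨(MulEquiv.ofBijective δ hδ).symm τ, ?_, fun y => ?_⟩
  · refine AlgEquiv.ext fun e => ?_
    apply (ιE : E →+* AlgebraicClosure K).injective
    apply (absClosureEmbedding K Kv).toRingHom.injective
    change absClosureEmbedding K Kv (ιE ((((MulEquiv.ofBijective δ hδ).symm τ : S) : E ≃ₐ[K] E) e)) =
      absClosureEmbedding K Kv (ιE (g e))
    rw [← hφ, ← hδj, hds, hτ, hψ]
  · rw [hds]
    exact (hτ y).symm

omit [Normal K E] in
/-- Corollary: such a `g` lies in the decomposition subgroup `S`. [cite: CasselsFrohlichANT1967, Ch. VII §1.1] -/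
theorem mem_of_algHom (ψ : L →ₐ[Kv] AlgebraicClosure Kv) (g : E ≃ₐ[K] E)
    (hψ : ∀ e : E, ψ (j e) = absClosureEmbedding K Kv (ιE (g e))) : g ∈ S := by
  obtain ⟨s, hs, -⟩ := exists_eq_of_algHom hφ hδ hδj ψ g hψ
  exact hs ▸ s.2

omit [Normal K E] in
/-- Corollary (`g = 1`): **a `K_v`-algebra map `L → K̄_v` extending `ι_v ∘ ιE` on `E` is `φ`.**
[cite: NeukirchANT1999, Ch. II (8.1)–(8.3)] -/
theorem apply_eq_of_algHom (ψ : L →ₐ[Kv] AlgebraicClosure Kv)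
    (hψ : ∀ e : E, ψ (j e) = absClosureEmbedding K Kv (ιE e)) (y : L) : ψ y = φ y := by
  obtain ⟨s, hs, h⟩ := exists_eq_of_algHom hφ hδ hδj ψ 1 (fun e => by rw [AlgEquiv.one_apply]; exact hψ e)
  have h1 : s = 1 := Subtype.ext hs
  rw [h y, h1, map_one, AlgEquiv.one_apply]

end LocalModel

/-! ## §2. Rigidity of the distinguished infinite place and embedding -/

section ArchRigidity

open ArchHerbrand

variable {K : Type} [Field K] {E : Type} [Field E] [Algebra K E] [FiniteDimensional K E] [IsGalois K E]
variable (v : InfinitePlace K) (ιE : E →ₐ[K] AlgebraicClosure K)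

/-- **A place `w ∣ v` whose completion admits a `K_v`-algebra map to `K̄_v` extending `ι_v ∘ ιE` is the distinguished
place `w_v`** (transport to `w_v` by `Gal(E/K)`-transitivity; the correcting element lies in `Stab(w_v)` by the rigidity
of the model). [cite: CasselsFrohlichANT1967, Ch. VII §1.1] [cite: NeukirchANT1999, Ch. II (8.1)] -/
theorem eq_archEmbPlace_of_algHom {w : InfinitePlace E} (hw : IsOver E v w)
    (ψ : haveI := liesOver_of_isOver v hw; w.Completion →ₐ[v.Completion] AlgebraicClosure v.Completion)
    (hψ : ∀ e : E, ψ (e : w.Completion) = absClosureEmbedding K v.Completion (ιE e)) :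
    w = archEmbPlace v ιE := by
  haveI := liesOver_of_isOver v hw
  haveI := liesOver_archEmbPlace v ιE
  haveI := normal_archEmbPlace_completion v ιE
  obtain ⟨g, hg⟩ := exists_smul_eq_of_isOver (isOver_archEmbPlace v ιE) hw
  let ψ' : (archEmbPlace v ιE).Completion →ₐ[v.Completion] AlgebraicClosure v.Completion :=
    { toRingHom := (ψ : w.Completion →+* AlgebraicClosure v.Completion).comp (galInfiniteCompletionMap g hg)
      commutes' := fun x => by
        change ψ (galInfiniteCompletionMap g hg (algebraMap v.Completion (archEmbPlace v ιE).Completion x)) = _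
        rw [galInfiniteCompletionMap_algebraMap_of_isOver v g hg, AlgHom.commutes] }
  have hψ' : ∀ e : E, ψ' ((algebraMap E (archEmbPlace v ιE).Completion : E →+* _) e) =
      absClosureEmbedding K v.Completion (ιE (g e)) := fun e => by
    change ψ (galInfiniteCompletionMap g hg (e : (archEmbPlace v ιE).Completion)) = _
    rw [galInfiniteCompletionMap_coe]
    exact hψ (g e)
  have hmem := LocalModel.mem_of_algHom (ιE := ιE) (φ := archPlaceEmbAlgHom v ιE)
    (j := (algebraMap E (archEmbPlace v ιE).Completion : E →+* _)) (δ := archDecompHom v (archEmbPlace v ιE))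
    (fun e => archPlaceEmb_coe v ιE e) (archDecompHom_bijective v ιE) (archDecompHom_coe v ιE) ψ' g hψ'
  rw [← hg]
  exact MulAction.mem_stabilizer_iff.mp hmem

/-- **Rigidity of the embedding**: a `K_v`-algebra map `E_w → K̄_v` extending `ι_v ∘ ιE` on a place `w = w_v` IS
`archPlaceEmb` (up to the transport of the completion along `w = w_v`). [cite: NeukirchANT1999, Ch. II (8.1)–(8.3)] -/
theorem algHom_apply_eq_archPlaceEmb {w : InfinitePlace E} (hw : IsOver E v w)
    (ψ : haveI := liesOver_of_isOver v hw; w.Completion →ₐ[v.Completion] AlgebraicClosure v.Completion)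
    (hψ : ∀ e : E, ψ (e : w.Completion) = absClosureEmbedding K v.Completion (ιE e))
    (h : w = archEmbPlace v ιE) (y : w.Completion) :
    ψ y = archPlaceEmb v ιE (cast (congrArg InfinitePlace.Completion h) y) := by
  subst h
  haveI := liesOver_archEmbPlace v ιE
  haveI := normal_archEmbPlace_completion v ιE
  exact LocalModel.apply_eq_of_algHom (ιE := ιE) (φ := archPlaceEmbAlgHom v ιE)
    (j := (algebraMap E (archEmbPlace v ιE).Completion : E →+* _)) (δ := archDecompHom v (archEmbPlace v ιE))
    (fun e => archPlaceEmb_coe v ιE e) (archDecompHom_bijective v ιE) (archDecompHom_coe v ιE) ψ hψ y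

end ArchRigidity

/-! ## §3. Finite places: `π_v^{E'} ∘ (J_E → J_{E'}) = π_v^{E}` -/

section Finite

open SemiLocal

variable {K : Type} [Field K] [NumberField K] {E : Type} [Field E] [NumberField E] [Algebra K E] [IsGalois K E]
variable {E' : Type} [Field E'] [NumberField E'] [Algebra K E'] [IsGalois K E'] [Algebra E E'] [IsScalarTower K E E']
variable (v : HeightOneSpectrum (𝓞 K)) (ιE : E →ₐ[K] AlgebraicClosure K) (ιE' : E' →ₐ[K] AlgebraicClosure K)

omit [IsGalois K E] [IsGalois K E'] in
/-- **The place `w' ∩ E` of `E` below a place `w' ∣ v` of `E'`**, as a place over `v`. [cite: CasselsFrohlichANT1967, Ch. II §10] -/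
def underPlace (w' : Place K E' v) : Place K E v :=
  ⟨(w' : HeightOneSpectrum (𝓞 E')).under (𝓞 E), by
    rw [HeightOneSpectrum.ext_iff, HeightOneSpectrum.under_asIdeal, HeightOneSpectrum.under_asIdeal,
      Ideal.under_under, ← HeightOneSpectrum.under_asIdeal]
    exact congrArg HeightOneSpectrum.asIdeal w'.under_eq⟩

omit [NumberField K] [NumberField E] [NumberField E'] [IsGalois K E] [IsGalois K E'] in
/-- `↑(underPlace w') = w' ∩ 𝓞 E`. [cite: CasselsFrohlichANT1967, Ch. II §10] -/
@[simp] theorem coe_underPlace (w' : Place K E' v) :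
    (underPlace (E := E) v w' : HeightOneSpectrum (𝓞 E)) = (w' : HeightOneSpectrum (𝓞 E')).under (𝓞 E) := rfl

omit [IsGalois K E] [IsGalois K E'] in
/-- **The local tower map `E_{w'∩E} → E'_{w'}` is `K_v`-linear** (`K_v → E_{w'∩E} → E'_{w'}` is `K_v → E'_{w'}`: both are
continuous and extend `K → E'`). [cite: CasselsFrohlichANT1967, Ch. II §10] -/
theorem adicCompletionOfUnder_algebraMap (w' : Place K E' v) (c : v.adicCompletion K) :
    adicCompletionOfUnder (𝓞 E) E E' (w' : HeightOneSpectrum (𝓞 E'))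
        (algebraMap (v.adicCompletion K) (((underPlace (E := E) v w' : Place K E v) : HeightOneSpectrum (𝓞 E)).adicCompletion E) c) =
      algebraMap (v.adicCompletion K) (((w' : HeightOneSpectrum (𝓞 E')).adicCompletion E')) c := by
  have key : (adicCompletionOfUnder (𝓞 E) E E' (w' : HeightOneSpectrum (𝓞 E'))) ∘
      (algebraMap (v.adicCompletion K) (((underPlace (E := E) v w' : Place K E v) : HeightOneSpectrum (𝓞 E)).adicCompletion E)) =
      algebraMap (v.adicCompletion K) (((w' : HeightOneSpectrum (𝓞 E')).adicCompletion E')) := by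
    refine HeightOneSpectrum.adicCompletion.ext_of_coe (B := 𝓞 K) (L := K) (w := v)
      (hf := (continuous_adicCompletionOfUnder E E' _).comp (continuous_adicCompletionOfLiesOver K E v _))
      (hf' := continuous_adicCompletionOfLiesOver K E' v _) (h := fun c => ?_)
    rw [Function.comp_apply, algebraMap_place_eq, algebraMap_place_eq, adicCompletionOfLiesOver_coe,
      adicCompletionOfLiesOver_coe, IsScalarTower.algebraMap_apply K E E' c]
    exact adicCompletionOfUnder_coe (K := E) (L := E') (w := (w' : HeightOneSpectrum (𝓞 E'))) (x := algebraMap K E c)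
  exact congrFun key c

omit [IsGalois K E] [IsGalois K E'] in
/-- **`E_{w'∩E} →ₐ[K_v] E'_{w'}`**, the local tower map as a `K_v`-algebra homomorphism. [cite: CasselsFrohlichANT1967, Ch. II §10] -/
def placeTowerAlgHom (w' : Place K E' v) :
    (((underPlace (E := E) v w' : Place K E v) : HeightOneSpectrum (𝓞 E)).adicCompletion E) →ₐ[v.adicCompletion K]
      ((w' : HeightOneSpectrum (𝓞 E')).adicCompletion E') :=
  { toRingHom := adicCompletionOfUnder (𝓞 E) E E' (w' : HeightOneSpectrum (𝓞 E'))
    commutes' := adicCompletionOfUnder_algebraMap v w' }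

omit [IsGalois K E] [IsGalois K E'] in
/-- Unfolding `placeTowerAlgHom`. [cite: CasselsFrohlichANT1967, Ch. II §10] -/
theorem placeTowerAlgHom_apply (w' : Place K E' v)
    (y : ((underPlace (E := E) v w' : Place K E v) : HeightOneSpectrum (𝓞 E)).adicCompletion E) :
    placeTowerAlgHom (E := E) v w' y = adicCompletionOfUnder (𝓞 E) E E' (w' : HeightOneSpectrum (𝓞 E')) y := rfl

variable (hι : ∀ e : E, ιE' (algebraMap E E' e) = ιE e)
include hι

omit [IsGalois K E] in
/-- `placeEmb^{E'} ∘ (E_{w'_v ∩ E} → E'_{w'_v})` extends `ι_v ∘ ιE` on `E`. [cite: NeukirchANT1999, Ch. II (8.1)] -/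
theorem placeEmb_placeTowerAlgHom_algebraMap (e : E) :
    (placeEmb v ιE').comp (placeTowerAlgHom (E := E) v (embPlace v ιE')) (algebraMap E _ e) =
      absClosureEmbedding K (v.adicCompletion K) (ιE e) := by
  change placeEmb v ιE' (adicCompletionOfUnder (𝓞 E) E E' _
    (e : (((embPlace v ιE' : Place K E' v) : HeightOneSpectrum (𝓞 E')).under (𝓞 E)).adicCompletion E)) = _
  rw [adicCompletionOfUnder_coe, placeEmb_coe, hι]

/-- **The distinguished place of `E'` lies over the distinguished place of `E`**: `w'_v ∩ E = w_v`.
[cite: CasselsFrohlichANT1967, Ch. II §10] [cite: NeukirchANT1999, Ch. II (8.1)] -/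
theorem underPlace_embPlace : underPlace (E := E) v (embPlace v ιE') = embPlace v ιE :=
  eq_embPlace_of_algHom v ιE _ (placeEmb_placeTowerAlgHom_algebraMap v ιE ιE' hι)

omit hι [IsGalois K E] [IsGalois K E'] [NumberField K] in
/-- Transport of a finite component along an equality of places. [cite: CasselsFrohlichANT1967, Ch. II §14] -/
theorem cast_snd_apply {w₁ w₂ : Place K E v} (h : w₁ = w₂) (a : AdeleRing (𝓞 E) E) :
    cast (congrArg (fun w : Place K E v => (w : HeightOneSpectrum (𝓞 E)).adicCompletion E) h)
      (a.2 (w₁ : HeightOneSpectrum (𝓞 E))) = a.2 (w₂ : HeightOneSpectrum (𝓞 E)) := by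
  subst h
  rfl

/-- **The finite place readouts are compatible with base change: `π_v^{E'}(x ↦ J_{E'}) = π_v^{E}(x)`.**
[cite: MilneADT2006, I Lemma 4.13 (proof)] [cite: CasselsFrohlichANT1967, Ch. II §10, §14] -/
theorem idelePlaceReadout_ideleBaseChange (x : ideleGroup E) :
    idelePlaceReadout v ιE' (Additive.ofMul (AdeleRing.ideleBaseChange E E' x)) =
      idelePlaceReadout v ιE (Additive.ofMul x) := by
  apply unitsVal_injective
  apply Units.ext
  rw [coe_unitsVal_idelePlaceReadout, coe_unitsVal_idelePlaceReadout, toMul_ofMul, toMul_ofMul,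
    AdeleRing.coe_ideleBaseChange, AdeleRing.baseChange_snd, FiniteAdeleRing.baseChange_apply]
  change (placeEmb v ιE').comp (placeTowerAlgHom (E := E) v (embPlace v ιE'))
      ((x : AdeleRing (𝓞 E) E).2 ((underPlace (E := E) v (embPlace v ιE') : Place K E v) : HeightOneSpectrum (𝓞 E))) = _
  rw [algHom_apply_eq_placeEmb v ιE _ (placeEmb_placeTowerAlgHom_algebraMap v ιE ιE' hι)
    (underPlace_embPlace v ιE ιE' hι), cast_snd_apply v (underPlace_embPlace v ιE ιE' hι)]

end Finite

/-! ## §4. Infinite places: `π_v^{E'} ∘ (J_E → J_{E'}) = π_v^{E}` -/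

section Infinite

open ArchHerbrand

variable {K : Type} [Field K] [NumberField K] {E : Type} [Field E] [NumberField E] [Algebra K E] [IsGalois K E]
variable {E' : Type} [Field E'] [NumberField E'] [Algebra K E'] [IsGalois K E'] [Algebra E E'] [IsScalarTower K E E']
variable (v : InfinitePlace K) (ιE : E →ₐ[K] AlgebraicClosure K) (ιE' : E' →ₐ[K] AlgebraicClosure K)

omit [NumberField K] [NumberField E] [NumberField E'] [IsGalois K E] [IsGalois K E'] in
/-- `w' ∣ v ⇒ (w'|_E) ∣ v`. [cite: CasselsFrohlichANT1967, Ch. II §10] -/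
theorem isOver_comap_of_isOver {w' : InfinitePlace E'} (hw' : IsOver E' v w') :
    IsOver E v (w'.comap (algebraMap E E')) := by
  change (w'.comap (algebraMap E E')).comap (algebraMap K E) = v
  rw [← InfinitePlace.comap_comp, ← IsScalarTower.algebraMap_eq]
  exact hw'

omit [NumberField K] [NumberField E] [NumberField E'] [IsGalois K E] [IsGalois K E'] in
/-- **The local tower map `E_{w'|_E} → E'_{w'}` is `K_v`-linear.** [cite: CasselsFrohlichANT1967, Ch. II §10] -/
theorem infiniteCompletionOfComap_algebraMap {w' : InfinitePlace E'} (hw' : IsOver E' v w') (c : v.Completion) :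
    haveI := liesOver_of_isOver v hw'
    haveI := liesOver_of_isOver v (isOver_comap_of_isOver (E := E) v hw')
    infiniteCompletionOfComap E E' w' (algebraMap v.Completion (w'.comap (algebraMap E E')).Completion c) =
      algebraMap v.Completion w'.Completion c := by
  haveI := liesOver_of_isOver v hw'
  haveI := liesOver_of_isOver v (isOver_comap_of_isOver (E := E) v hw')
  induction c using InfinitePlace.Completion.induction_on with
  | hp =>
    exact isClosed_eq ((continuous_infiniteCompletionOfComap E E' w').comp NumberField.LiesOver.continuous_completionMap)
      NumberField.LiesOver.continuous_completionMap
  | ih a =>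
    rw [InfinitePlace.Completion.algebraMap_coe, InfinitePlace.Completion.algebraMap_coe]
    change infiniteCompletionOfComap E E' w' ((algebraMap K E a.ofAbs : E) : (w'.comap (algebraMap E E')).Completion) =
      ((algebraMap K E' a.ofAbs : E') : w'.Completion)
    rw [infiniteCompletionOfComap_coe, ← IsScalarTower.algebraMap_apply]

omit [NumberField E] [NumberField E'] [IsGalois K E] [IsGalois K E'] in
/-- **`E_{w'|_E} →ₐ[K_v] E'_{w'}`**, the local tower map as a `K_v`-algebra homomorphism. [cite: CasselsFrohlichANT1967, Ch. II §10] -/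
def archTowerAlgHom {w' : InfinitePlace E'} (hw' : IsOver E' v w') :
    haveI := liesOver_of_isOver v hw'
    haveI := liesOver_of_isOver v (isOver_comap_of_isOver (E := E) v hw')
    (w'.comap (algebraMap E E')).Completion →ₐ[v.Completion] w'.Completion :=
  haveI := liesOver_of_isOver v hw'
  haveI := liesOver_of_isOver v (isOver_comap_of_isOver (E := E) v hw')
  { toRingHom := infiniteCompletionOfComap E E' w'
    commutes' := infiniteCompletionOfComap_algebraMap v hw' }

variable (hι : ∀ e : E, ιE' (algebraMap E E' e) = ιE e)
include hι

omit [NumberField E] [IsGalois K E] in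
/-- `archPlaceEmb^{E'} ∘ (E_{w'_v|_E} → E'_{w'_v})` extends `ι_v ∘ ιE` on `E`. [cite: NeukirchANT1999, Ch. II (8.1)] -/
theorem archPlaceEmb_archTowerAlgHom_coe (e : E) :
    (haveI := liesOver_archEmbPlace v ιE'
     haveI := liesOver_of_isOver v (isOver_comap_of_isOver (E := E) v (isOver_archEmbPlace v ιE'))
     (archPlaceEmbAlgHom v ιE').comp (archTowerAlgHom (E := E) v (isOver_archEmbPlace v ιE')))
        (e : ((archEmbPlace v ιE').comap (algebraMap E E')).Completion) =
      absClosureEmbedding K v.Completion (ιE e) := by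
  change archPlaceEmb v ιE' (infiniteCompletionOfComap E E' _
    (e : ((archEmbPlace v ιE').comap (algebraMap E E')).Completion)) = _
  rw [infiniteCompletionOfComap_coe, archPlaceEmb_coe, hι]

/-- **The distinguished infinite place of `E'` restricts to that of `E`**: `w'_v|_E = w_v`.
[cite: CasselsFrohlichANT1967, Ch. VII §1.1] [cite: NeukirchANT1999, Ch. II (8.1)] -/
theorem comap_archEmbPlace : (archEmbPlace v ιE').comap (algebraMap E E') = archEmbPlace v ιE :=
  eq_archEmbPlace_of_algHom v ιE (isOver_comap_of_isOver (E := E) v (isOver_archEmbPlace v ιE')) _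
    (archPlaceEmb_archTowerAlgHom_coe v ιE ιE' hι)

omit hι [NumberField K] [NumberField E] [NumberField E'] [IsGalois K E] [IsGalois K E'] [IsScalarTower K E E'] in
/-- Transport of an infinite component along an equality of places. [cite: CasselsFrohlichANT1967, Ch. II §14] -/
theorem cast_fst_apply {w₁ w₂ : InfinitePlace E} (h : w₁ = w₂) (a : InfiniteAdeleRing E) :
    cast (congrArg InfinitePlace.Completion h) (a w₁) = a w₂ := by
  subst h
  rfl

/-- **The infinite place readouts are compatible with base change: `π_v^{E'}(x ↦ J_{E'}) = π_v^{E}(x)`.**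
[cite: MilneADT2006, I Lemma 4.13 (proof)] [cite: CasselsFrohlichANT1967, Ch. II §10, §14] -/
theorem ideleInfPlaceReadout_ideleBaseChange (x : ideleGroup E) :
    ideleInfPlaceReadout v ιE' (Additive.ofMul (AdeleRing.ideleBaseChange E E' x)) =
      ideleInfPlaceReadout v ιE (Additive.ofMul x) := by
  apply unitsVal_injective
  apply Units.ext
  rw [coe_unitsVal_ideleInfPlaceReadout, coe_unitsVal_ideleInfPlaceReadout, toMul_ofMul, toMul_ofMul,
    AdeleRing.coe_ideleBaseChange, AdeleRing.baseChange_fst, Literature.NumberTheory.Automorphic.InfiniteAdeleRing.baseChange_apply]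
  change (haveI := liesOver_archEmbPlace v ιE'
     haveI := liesOver_of_isOver v (isOver_comap_of_isOver (E := E) v (isOver_archEmbPlace v ιE'))
     (archPlaceEmbAlgHom v ιE').comp (archTowerAlgHom (E := E) v (isOver_archEmbPlace v ιE')))
      ((x : AdeleRing (𝓞 E) E).1 ((archEmbPlace v ιE').comap (algebraMap E E'))) = _
  rw [algHom_apply_eq_archPlaceEmb v ιE (isOver_comap_of_isOver (E := E) v (isOver_archEmbPlace v ιE')) _
    (archPlaceEmb_archTowerAlgHom_coe v ιE ιE' hι) (comap_archEmbPlace v ιE ιE' hι),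
    cast_fst_apply (comap_archEmbPlace v ιE ιE' hι)]

end Infinite

end IdeleReadout

end Literature.NumberTheory.GaloisRepresentations

end
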